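import Mathlib

/-!
# Solo-blind: the periodic-resolvent bound from a monodromy-resolvent bound and a propagator bound,
  and the resulting `n`-power exponent `γ = 2a + b` (paper §24.86(7), PLAN §129.11 (ii)/(v); residual R7)

For a `T`-periodic linear evolution `u̇ = A(t)u + f` with propagator `U(t,τ)`, monodromy `M = U(T,0)`,
`G := sup_{0 ≤ τ ≤ t ≤ T} ‖U(t,τ)‖` and `K := ‖(1 − M)⁻¹‖`, Duhamel and periodicity give the two
inequalities
* `‖u(0)‖ ≤ K · (T·G·‖f‖_∞)`            (from `(1 − M)u(0) = ∫₀ᵀ U(T,τ)f(τ)dτ`),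
* `‖u(t)‖ ≤ G‖u(0)‖ + T·G·‖f‖_∞`        (from `u(t) = U(t,0)u(0) + ∫₀ᵗ U(t,τ)f(τ)dτ`),
and the real-number core proved here turns them into the resolvent bound
`‖u‖_∞ ≤ T·G·(1 + G·K)·‖f‖_∞` (`periodic_resolvent_bound`).  If along the door's subsequence the
propagator and the monodromy resolvent are polynomially bounded, `G ≤ c₁ n^a`, `K ≤ c₂ n^b` (`n ≥ 1`),
the resolvent constant is `≤ T(c₁ + c₁²c₂)·n^(2a+b)` (`resolvent_npower`): the exponent that enters the
closing count `(N₀+1)/3 > 2γ` of (E_{N₀}) is `γ = 2a + b` — the propagator exponent counts TWICE.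
-/

namespace Summit.AnomalousDissipation.AnomalousDissipation.Theorems

/-- **Periodic resolvent from monodromy resolvent and propagator.**  The two Duhamel inequalities
`u0 ≤ K·(T·G·F)` and `ut ≤ G·u0 + T·G·F` give `ut ≤ T·G·(1 + G·K)·F`. -/
theorem periodic_resolvent_bound {T G K F u0 ut : ℝ} (hG : 0 ≤ G)
    (h0 : u0 ≤ K * (T * G * F)) (ht : ut ≤ G * u0 + T * G * F) :
    ut ≤ T * G * (1 + G * K) * F := by
  have h1 : G * u0 ≤ G * (K * (T * G * F)) := mul_le_mul_of_nonneg_left h0 hG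
  nlinarith [h1, ht]

/-- The bound `T·G·(1 + G·K)` is monotone in the propagator constant `G` and in the monodromy
resolvent constant `K` (so upper enclosures of `G`, `K` may be substituted). -/
theorem periodic_resolvent_const_mono {T G G' K K' : ℝ} (hT : 0 ≤ T) (hG : 0 ≤ G) (hK : 0 ≤ K)
    (hGG : G ≤ G') (hKK : K ≤ K') :
    T * G * (1 + G * K) ≤ T * G' * (1 + G' * K') := by
  have hG' : 0 ≤ G' := hG.trans hGG
  have hK' : 0 ≤ K' := hK.trans hKK
  have h1 : G * K ≤ G' * K' := mul_le_mul hGG hKK hK hG'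
  have h2 : T * G ≤ T * G' := mul_le_mul_of_nonneg_left hGG hT
  have h3 : 0 ≤ 1 + G * K := by positivity
  calc T * G * (1 + G * K) ≤ T * G' * (1 + G * K) := mul_le_mul_of_nonneg_right h2 h3
    _ ≤ T * G' * (1 + G' * K') := by
        apply mul_le_mul_of_nonneg_left _ (mul_nonneg hT hG')
        linarith

/-- **The `n`-power exponent.**  Polynomial bounds `G ≤ c₁ n^a`, `K ≤ c₂ n^b` along `n ≥ 1`
(`a, b ≥ 0`) give the resolvent constant `T·G·(1 + G·K) ≤ T·(c₁ + c₁²·c₂)·n^(2a + b)`. -/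
theorem resolvent_npower {T G K c₁ c₂ a b n : ℝ} (hn : 1 ≤ n) (hT : 0 ≤ T) (hG : 0 ≤ G)
    (hK : 0 ≤ K) (hc₁ : 0 ≤ c₁) (ha : 0 ≤ a) (hb : 0 ≤ b)
    (hGb : G ≤ c₁ * n ^ a) (hKb : K ≤ c₂ * n ^ b) :
    T * G * (1 + G * K) ≤ T * (c₁ + c₁ ^ 2 * c₂) * n ^ (2 * a + b) := by
  have hn0 : 0 < n := by linarith
  have hna : 1 ≤ n ^ a := Real.one_le_rpow hn ha
  have hnb : 0 ≤ n ^ b := Real.rpow_nonneg hn0.le b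
  have hpow : n ^ (2 * a + b) = n ^ a * n ^ a * n ^ b := by
    rw [Real.rpow_add hn0, show (2 : ℝ) * a = a + a by ring, Real.rpow_add hn0]
  have hc₂ : 0 ≤ c₂ * n ^ b := hK.trans hKb
  -- G·K ≤ c₁ n^a · c₂ n^b
  have hGK : G * K ≤ c₁ * n ^ a * (c₂ * n ^ b) := mul_le_mul hGb hKb hK (by positivity)
  -- G(1 + GK) ≤ c₁ n^a (1 + c₁ n^a c₂ n^b)
  have h1 : G * (1 + G * K) ≤ c₁ * n ^ a * (1 + c₁ * n ^ a * (c₂ * n ^ b)) := by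
    apply mul_le_mul hGb _ (by positivity) (by positivity)
    linarith
  -- 1 ≤ n^a n^b? No: only `1 + X n^a n^b ≤ (1 + X) n^a n^b` fails when n^b < 1 is impossible since
  -- n ≥ 1, b ≥ 0 ⇒ n^b ≥ 1.
  have hnb1 : 1 ≤ n ^ b := Real.one_le_rpow hn hb
  have h2 : c₁ * n ^ a * (1 + c₁ * n ^ a * (c₂ * n ^ b))
      ≤ (c₁ + c₁ ^ 2 * c₂) * (n ^ a * n ^ a * n ^ b) := by
    have hna0 : 0 ≤ n ^ a := le_trans zero_le_one hna
    have hc₂' : 0 ≤ c₂ := by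
      by_contra hneg
      push Not at hneg
      have : c₂ * n ^ b < 0 := mul_neg_of_neg_of_pos hneg (by linarith)
      linarith
    -- (i) c₁ n^a ≤ c₁ (n^a n^a n^b) since n^a, n^b ≥ 1
    have hab : n ^ a ≤ n ^ a * n ^ a * n ^ b := by
      have e : n ^ a * 1 * 1 ≤ n ^ a * n ^ a * n ^ b :=
        mul_le_mul (mul_le_mul_of_nonneg_left hna hna0) hnb1 zero_le_one (by positivity)
      simpa using e
    have e1 : c₁ * n ^ a ≤ c₁ * (n ^ a * n ^ a * n ^ b) := mul_le_mul_of_nonneg_left hab hc₁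
    -- (ii) the quadratic term is an identity
    have e2 : c₁ * n ^ a * (c₁ * n ^ a * (c₂ * n ^ b)) = c₁ ^ 2 * c₂ * (n ^ a * n ^ a * n ^ b) := by
      ring
    calc c₁ * n ^ a * (1 + c₁ * n ^ a * (c₂ * n ^ b))
        = c₁ * n ^ a + c₁ * n ^ a * (c₁ * n ^ a * (c₂ * n ^ b)) := by ring
      _ ≤ c₁ * (n ^ a * n ^ a * n ^ b) + c₁ ^ 2 * c₂ * (n ^ a * n ^ a * n ^ b) := by
          rw [e2]; linarith [e1]
      _ = (c₁ + c₁ ^ 2 * c₂) * (n ^ a * n ^ a * n ^ b) := by ring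
  calc T * G * (1 + G * K) = T * (G * (1 + G * K)) := by ring
    _ ≤ T * (c₁ * n ^ a * (1 + c₁ * n ^ a * (c₂ * n ^ b))) := mul_le_mul_of_nonneg_left h1 hT
    _ ≤ T * ((c₁ + c₁ ^ 2 * c₂) * (n ^ a * n ^ a * n ^ b)) := mul_le_mul_of_nonneg_left h2 hT
    _ = T * (c₁ + c₁ ^ 2 * c₂) * n ^ (2 * a + b) := by rw [hpow]; ring

end Summit.AnomalousDissipation.AnomalousDissipation.Theorems
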